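import Summits.BirchSwinnertonDyer.BirchSwinnertonDyer.Theorems.GenusKolyvaginAtTwoGenusPrimitiveSupplyAtTwoTwistingPrimeLocal
import Literature.NumberTheory.Automorphic.ChebotarevArtinRepHolds
import HarnessLib

/-!
# Route `GenusKolyvaginAtTwo`, crux #2 `GenusPrimitiveSupplyAtTwo` (stmt-BirchSwinnertonDyer-22136):
# twisting primes at `2` for TWO classes with abelian side conditions; KOLYVAGIN twisting primes

Width seat `bsd-line-gk2-p4` g7, cell `bsd-f1-sign2`; helper (`--supports stmt-BirchSwinnertonDyer-22136`),
third file of the series (`…TwistingPrimeLocal` = ingredients, `…TwistingPrime` = one class / prime Heegner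
fields). THEOREMS ONLY: no definition, no named fact, no `sorry`; no item is closed; BSD is not proved.

* §7 `exists_torsionFixing_mem_smul_h1Eval_ne` — the key lemma with the stabiliser of a root of unity
  replaced by ANY subgroup `A ≤ Γ_ℚ` containing all commutators; `…_pair` — ONE `h ∈ Γ_{ℚ(E[2])} ∩ A`
  serving two non-zero classes `x, y` at once (a group is not the union of two proper subgroups).
* §8 `exists_twistingPrime_pair` — for `Δ(W) < 0`, `ρ̄_{W,2}` onto, `x, y ≠ 0` in `H¹(ℚ, E[2])`, an OPEN
  commutator-closed `A`, `m ≥ 1`, finitely many rational primes `B₀` and places `S'` to avoid: a prime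
  `ℓ ∉ B₀`, `ℓ ∤ m`, `m ∣ ℓ + 1`, a place `v ∋ ℓ` off `S'` with an arithmetic Frobenius `c₀·t`,
  `t ∈ Γ_{ℚ(E[2])} ∩ A`, and `x_ℓ ≠ 0`, `y_ℓ ≠ 0` in `H¹(ℚ_ℓ, E[2])` (unconditional Čebotarev:
  `Automorphic.chebotarev_artinRep_holds` via `absoluteGaloisGroup.frobenius_dense`).
* §9 `exists_kolyvaginPrime_not_mem_torsionLocalKer_pair` — `K` imaginary quadratic, `A = Γ_K`: the prime
  is moreover a KOLYVAGIN PRIME for `(E, K, 2)` in Gross's sense (`IsKolyvaginPrime N W K 2 ℓ`: `ℓ ∤ 2Nd_K`,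
  inert, `Frob_ℓ = Frob_∞` on `K(E[2])`), of depth one. This is the Selmer-side (Čebotarev) half of the
  prime-level SUPPLY in the LEAD's LEVEL LAW (`Lines/genus-supply-depthlaw.md` §3), for classes of ONE
  curve; the class of the twin `E^{(d_K)}` needs the identification `H¹(ℚ, E^{(d)}[2]) = H¹(ℚ, E[2])`
  (not typed here), and depth `≥ 2` (`Frob = c₀` on `E[4]`) is out of reach of this argument
  (Lawson–Wuthrich's class; the cell's entangled curves).
References: [MazurRubin2010] Prop. 3.3, Lemma 3.5; [GrossLMS1991] §3, §9; [McCallumLMS1991] §3 Cor. 3.2.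
-/

set_option linter.dupNamespace false -- tree convention: `Summit.BirchSwinnertonDyer.BirchSwinnertonDyer.Theorems` (summit = sub-problem)
set_option autoImplicit false

noncomputable section

open scoped Classical Pointwise

namespace Summit.BirchSwinnertonDyer.BirchSwinnertonDyer.Theorems.GenusKolyTwistingPrime

open WeierstrassCurve NumberField IsDedekindDomain Field
open Literature.NumberTheory.GaloisRepresentations Literature.NumberTheory.EllipticCurves
open Literature.NumberTheory

/-! ## §7 Two classes at once; commutator-closed side conditions -/

section Pair

variable (W : WeierstrassCurve ℚ) [W.IsElliptic]

omit [W.IsElliptic] in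
/-- **A group is not the union of two proper subgroups**: if `T ⊄ H₁` and `T ⊄ H₂` then some
element of `T` lies outside both. [folklore] -/
theorem exists_mem_not_mem_not_mem {G : Type*} [Group G] {T H₁ H₂ : Subgroup G}
    (h₁ : ∃ a ∈ T, a ∉ H₁) (h₂ : ∃ b ∈ T, b ∉ H₂) : ∃ g ∈ T, g ∉ H₁ ∧ g ∉ H₂ := by
  obtain ⟨a, haT, ha⟩ := h₁
  obtain ⟨b, hbT, hb⟩ := h₂
  by_cases ha2 : a ∈ H₂
  · by_cases hb1 : b ∈ H₁
    · refine ⟨a * b, mul_mem haT hbT, fun h ↦ ha ?_, fun h ↦ hb ?_⟩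
      · simpa using mul_mem h (inv_mem hb1)
      · simpa using mul_mem (inv_mem ha2) h
    · exact ⟨b, hbT, hb1, hb⟩
  · exact ⟨a, haT, ha, ha2⟩

/-- Conjugates of elements of a subgroup containing all commutators stay in it. [folklore] -/
theorem conj_mem_of_commutator_mem {G : Type*} [Group G] {A : Subgroup G}
    (hA : ∀ γ δ : G, γ * δ * γ⁻¹ * δ⁻¹ ∈ A) (σ : G) {h : G} (hh : h ∈ A) : σ * h * σ⁻¹ ∈ A := by
  have e : σ * h * σ⁻¹ = (σ * h * σ⁻¹ * h⁻¹) * h := by group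
  rw [e]; exact mul_mem (hA σ h) hh

/-- **KEY LEMMA, commutator-closed form.** For `x ≠ 0` in `H¹(ℚ, E[2])` (`ρ̄_{W,2}` onto, `Δ(W) < 0`),
a complex conjugation `c₀` and ANY subgroup `A ≤ Γ_ℚ` containing all commutators (e.g. the fixer of an
abelian extension of `ℚ`: roots of unity, square roots, an imaginary quadratic field): some
`h ∈ Γ_{ℚ(E[2])} ∩ A` has `c₀ • [x, h] ≠ [x, h]`. Same proof as `exists_torsionFixing_smul_h1Eval_ne`.
[cite: MazurRubin2010, Lemma 3.5 and Prop. 3.3 (choice of twisting primes)] [cite: GrossLMS1991, §9 Prop. 9.1] -/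
theorem exists_torsionFixing_mem_smul_h1Eval_ne (hsurj : W.HasSurjectiveModNGaloisRep 2)
    (hΔ : W.Δ < 0) {c₀ : absoluteGaloisGroup ℚ} (hc₀ : IsComplexConjugation (Rat.castHom ℝ) c₀)
    {x : galH1Torsion W (2 : ℤ)} (hx : x ≠ 0) (A : Subgroup (absoluteGaloisGroup ℚ))
    (hA : ∀ γ δ : absoluteGaloisGroup ℚ, γ * δ * γ⁻¹ * δ⁻¹ ∈ A) :
    ∃ h ∈ torsionFixing W (2 : ℤ), h ∈ A ∧
      c₀ • h1Eval W (2 : ℤ) x h ≠ h1Eval W (2 : ℤ) x h := by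
  -- Step 1: some `h ∈ Γ_{ℚ(E[2])} ∩ A` has `[x, h] ≠ 0`
  have step1 : ∃ h ∈ torsionFixing W (2 : ℤ), h ∈ A ∧ h1Eval W (2 : ℤ) x h ≠ 0 := by
    by_contra hcon
    push Not at hcon
    apply hx
    apply h1_restriction_injective_two_rat W hsurj
    intro ρ hρ
    apply eq_zero_of_forall_smul_eq W hsurj
    intro γ
    have hc1 : γ * ρ * γ⁻¹ ∈ torsionFixing W (2 : ℤ) := (torsionFixing_normal W _).conj_mem ρ hρ γ
    have hcomm_fix : γ * ρ * γ⁻¹ * ρ⁻¹ ∈ torsionFixing W (2 : ℤ) := mul_mem hc1 (inv_mem hρ)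
    have h0 := hcon _ hcomm_fix (hA γ ρ)
    rw [h1Eval_mul W _ x hc1, h1Eval_conj W _ x γ hρ, h1Eval_inv W _ x hρ, add_neg_eq_zero] at h0
    exact h0
  -- Step 2: `c₀` cannot fix every value
  by_contra hcon
  push Not at hcon
  obtain ⟨h₁, hh₁, hA₁, hv₁⟩ := step1
  obtain ⟨v, hv⟩ : ∃ v : geomTorsion W (2 : ℤ), c₀ • v ≠ v :=
    KolyvaginEigenTwo.exists_twoTorsion_smul_ne_of_Δ_neg W hΔ hc₀
  apply hv
  by_cases hv0 : v = 0
  · rw [hv0, smul_zero]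
  have hsurj' : W.HasSurjectiveModNGaloisRep ((2 : ℕ) : ℤ) := by simpa using hsurj
  have h2Q : ((2 : ℕ) : ℚ) ≠ 0 := by norm_num
  obtain ⟨σ, hσ⟩ := exists_smul_eq_of_hasSurjectiveModNGaloisRep W 2 h2Q hsurj' hv₁ hv0
  have hmem : σ * h₁ * σ⁻¹ ∈ torsionFixing W (2 : ℤ) := (torsionFixing_normal W _).conj_mem h₁ hh₁ σ
  have hfix := hcon _ hmem (conj_mem_of_commutator_mem hA σ hA₁)
  rwa [h1Eval_conj W _ x σ hh₁, hσ] at hfix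

/-- **Two classes at once.** For `x, y ≠ 0` in `H¹(ℚ, E[2])` and `A` as above, ONE `h ∈ Γ_{ℚ(E[2])} ∩ A`
has both `c₀ • [x, h] ≠ [x, h]` and `c₀ • [y, h] ≠ [y, h]`: the elements of `Γ_{ℚ(E[2])} ∩ A` failing
either condition form two PROPER subgroups (key lemma), and a group is not the union of two proper
subgroups. [cite: MazurRubin2010, Lemma 3.5 and Prop. 3.3 (choice of twisting primes)] -/
theorem exists_torsionFixing_mem_smul_h1Eval_ne_pair (hsurj : W.HasSurjectiveModNGaloisRep 2)
    (hΔ : W.Δ < 0) {c₀ : absoluteGaloisGroup ℚ} (hc₀ : IsComplexConjugation (Rat.castHom ℝ) c₀)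
    {x y : galH1Torsion W (2 : ℤ)} (hx : x ≠ 0) (hy : y ≠ 0) (A : Subgroup (absoluteGaloisGroup ℚ))
    (hA : ∀ γ δ : absoluteGaloisGroup ℚ, γ * δ * γ⁻¹ * δ⁻¹ ∈ A) :
    ∃ h ∈ torsionFixing W (2 : ℤ), h ∈ A ∧
      c₀ • h1Eval W (2 : ℤ) x h ≠ h1Eval W (2 : ℤ) x h ∧
      c₀ • h1Eval W (2 : ℤ) y h ≠ h1Eval W (2 : ℤ) y h := by
  -- the subgroup of `Γ_{ℚ(E[2])}` on which `c₀` fixes `[z, ·]`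
  let Kz : galH1Torsion W (2 : ℤ) → Subgroup (absoluteGaloisGroup ℚ) := fun z ↦
    { carrier := {h | h ∈ torsionFixing W (2 : ℤ) ∧ c₀ • h1Eval W (2 : ℤ) z h = h1Eval W (2 : ℤ) z h}
      one_mem' := ⟨one_mem _, by rw [h1Eval_one, smul_zero]⟩
      mul_mem' := by
        rintro a b ⟨ha, ha'⟩ ⟨hb, hb'⟩
        exact ⟨mul_mem ha hb, by rw [h1Eval_mul W _ z ha, smul_add, ha', hb']⟩
      inv_mem' := by
        rintro a ⟨ha, ha'⟩
        exact ⟨inv_mem ha, by rw [h1Eval_inv W _ z ha, smul_neg, ha']⟩ }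
  have hKz : ∀ (z : galH1Torsion W (2 : ℤ)) (h : absoluteGaloisGroup ℚ), h ∈ Kz z ↔
      h ∈ torsionFixing W (2 : ℤ) ∧ c₀ • h1Eval W (2 : ℤ) z h = h1Eval W (2 : ℤ) z h :=
    fun z h ↦ Iff.rfl
  have hex : ∀ z : galH1Torsion W (2 : ℤ), z ≠ 0 →
      ∃ a ∈ torsionFixing W (2 : ℤ) ⊓ A, a ∉ Kz z := fun z hz ↦ by
    obtain ⟨h, hhT, hhA, hh⟩ := exists_torsionFixing_mem_smul_h1Eval_ne W hsurj hΔ hc₀ hz A hA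
    exact ⟨h, ⟨hhT, hhA⟩, fun hK ↦ hh ((hKz z h).mp hK).2⟩
  obtain ⟨g, ⟨hgT, hgA⟩, hgx, hgy⟩ := exists_mem_not_mem_not_mem (hex x hx) (hex y hy)
  refine ⟨g, hgT, hgA, fun h ↦ hgx ((hKz x g).mpr ⟨hgT, h⟩), fun h ↦ hgy ((hKz y g).mpr ⟨hgT, h⟩)⟩

end Pair

/-! ## §8 Twisting primes for two classes with commutator-closed side conditions -/

section PairMain

variable (W : WeierstrassCurve ℚ) [W.IsElliptic]

/-- **TWISTING PRIMES AT `2`, GENERAL FORM.** `W/ℚ` elliptic, `Δ(W) < 0`, `ρ̄_{W,2}` onto, `c₀` a complex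
conjugation, `x, y ≠ 0` in `H¹(ℚ, E[2])`, `A ≤ Γ_ℚ` an OPEN subgroup containing all commutators (the fixer
of any finite abelian extension of `ℚ`), `m ≥ 1`, a finite set `B₀` of rational primes and a finite set
`S'` of places of `ℚ` to avoid. Then there are a prime `ℓ ∉ B₀`, `ℓ ∤ m`, a place `v ∋ ℓ`, `v ∉ S'`, and an
arithmetic Frobenius at `v` of the form `c₀ · t` with `t ∈ Γ_{ℚ(E[2])} ∩ A` (so it acts as `c₀` on `E[2]`
and on everything `A` fixes), with `m ∣ ℓ + 1` and BOTH `x_ℓ ≠ 0`, `y_ℓ ≠ 0` in `H¹(ℚ_ℓ, E[2])`.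
Proof as `exists_twistingPrime`, with the two-class key lemma and `A` added to the open set.
[cite: MazurRubin2010, Prop. 3.3 and Lemma 3.5 (twisting primes via Čebotarev)] [cite: GrossLMS1991, §9 Prop. 9.6]
[cite: McCallumLMS1991, §3 Cor. 3.2] -/
theorem exists_twistingPrime_pair (hsurj : W.HasSurjectiveModNGaloisRep 2) (hΔ : W.Δ < 0)
    {c₀ : absoluteGaloisGroup ℚ} (hc₀ : IsComplexConjugation (Rat.castHom ℝ) c₀)
    {x y : galH1Torsion W (2 : ℤ)} (hx : x ≠ 0) (hy : y ≠ 0)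
    (A : Subgroup (absoluteGaloisGroup ℚ)) (hAopen : IsOpen (A : Set (absoluteGaloisGroup ℚ)))
    (hA : ∀ γ δ : absoluteGaloisGroup ℚ, γ * δ * γ⁻¹ * δ⁻¹ ∈ A)
    {m : ℕ} (hm : m ≠ 0) (B₀ : Finset ℕ) {S' : Set (HeightOneSpectrum (𝓞 ℚ))} (hS' : S'.Finite) :
    ∃ ℓ : ℕ, ∃ _ : Fact ℓ.Prime, ℓ ∉ B₀ ∧ ¬ ℓ ∣ m ∧ m ∣ ℓ + 1 ∧
      (∃ (v : HeightOneSpectrum (𝓞 ℚ)) (𝔓 : Ideal (absIntegers (𝓞 ℚ) ℚ))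
          (t : absoluteGaloisGroup ℚ), v ∉ S' ∧ (ℓ : 𝓞 ℚ) ∈ v.asIdeal ∧ 𝔓 ∈ v.primesAbove ∧
          IsArithFrobAt (𝓞 ℚ) (c₀ * t) 𝔓 ∧ t ∈ torsionFixing W (2 : ℤ) ∧ t ∈ A) ∧
      x ∉ W.torsionLocalKer ℚ_[ℓ] (2 : ℤ) ∧ y ∉ W.torsionLocalKer ℚ_[ℓ] (2 : ℤ) := by
  classical
  haveI : NeZero m := ⟨hm⟩
  have hn0 : (2 : ℤ) ≠ 0 := two_ne_zero
  have hq0 : ((m : ℕ) : AlgebraicClosure ℚ) ≠ 0 := by exact_mod_cast hm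
  haveI : NeZero ((m : ℕ) : AlgebraicClosure ℚ) := ⟨hq0⟩
  obtain ⟨ζ, hζ⟩ := IsAlgClosed.exists_root (Polynomial.cyclotomic m (AlgebraicClosure ℚ))
    (Polynomial.degree_cyclotomic_pos m _ (Nat.pos_of_ne_zero hm)).ne'
  have hprim : IsPrimitiveRoot ζ m := Polynomial.isRoot_cyclotomic_iff.mp hζ
  -- ### the commutator-closed subgroup `Stab ζ ⊓ A` and the two-class key lemma
  set Aζ : Subgroup (absoluteGaloisGroup ℚ) := MulAction.stabilizer (absoluteGaloisGroup ℚ) ζ ⊓ A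
    with hAζ
  have hAζcomm : ∀ γ δ : absoluteGaloisGroup ℚ, γ * δ * γ⁻¹ * δ⁻¹ ∈ Aζ := fun γ δ ↦
    ⟨commutator_smul_rootOfUnity hprim γ δ, hA γ δ⟩
  obtain ⟨h₀, hh₀T, ⟨hh₀ζ, hh₀A⟩, hh₀x, hh₀y⟩ :=
    exists_torsionFixing_mem_smul_h1Eval_ne_pair W hsurj hΔ hc₀ hx hy Aζ hAζcomm
  have hh₀ζ' : h₀ • ζ = ζ := hh₀ζ
  -- ### the finite exceptional set of places of `ℚ`
  set B : Finset ℕ := m.primeFactors ∪ B₀ with hB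
  set S : Set (HeightOneSpectrum (𝓞 ℚ)) :=
    {v | ∃ q ∈ B, q.Prime ∧ (q : 𝓞 ℚ) ∈ v.asIdeal} ∪ S' with hS
  have hSfin : S.Finite := by
    refine Set.Finite.union ?_ hS'
    have : {v : HeightOneSpectrum (𝓞 ℚ) | ∃ q ∈ B, q.Prime ∧ (q : 𝓞 ℚ) ∈ v.asIdeal} ⊆
        ⋃ q ∈ (B.filter Nat.Prime), {v | (q : 𝓞 ℚ) ∈ v.asIdeal} := by
      intro v ⟨q, hqB, hq, hqv⟩
      simp only [Set.mem_iUnion, Finset.mem_filter]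
      exact ⟨q, ⟨hqB, hq⟩, hqv⟩
    refine Set.Finite.subset (Set.Finite.biUnion (Finset.finite_toSet _) fun q hq ↦ ?_) this
    rw [Finset.coe_filter, Set.mem_setOf_eq] at hq
    have hsub : {v : HeightOneSpectrum (𝓞 ℚ) | (q : 𝓞 ℚ) ∈ v.asIdeal}.Subsingleton :=
      fun v hv v' hv' ↦ HeightOneSpectrum.eq_of_natCast_mem_rat hq.2 hv hv'
    exact hsub.finite
  -- ### Čebotarev: a Frobenius in the open set `c₀ h₀ · (𝒩 ∩ Stab ζ ∩ A)`
  set xs : Bool → galH1Torsion W (2 : ℤ) := fun i ↦ if i then x else y with hxs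
  set 𝒩 := evalKer W (2 : ℤ) xs with h𝒩
  have h𝒩open : IsOpen (𝒩 : Set (absoluteGaloisGroup ℚ)) :=
    isOpen_evalKer W _ _ (isOpen_torsionFixing W hn0)
  set St : Subgroup (absoluteGaloisGroup ℚ) := MulAction.stabilizer (absoluteGaloisGroup ℚ) ζ with hSt
  have hStopen : IsOpen (St : Set (absoluteGaloisGroup ℚ)) := by
    haveI : FiniteDimensional ℚ (IntermediateField.adjoin ℚ {ζ}) :=
      IntermediateField.adjoin.finiteDimensional
        ((AlgebraicClosure.isAlgebraic ℚ).isAlgebraic ζ).isIntegral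
    refine Subgroup.isOpen_mono (H₁ := (IntermediateField.adjoin ℚ {ζ}).fixingSubgroup) ?_
      (IntermediateField.fixingSubgroup_isOpen _)
    intro σ hσ
    rw [IntermediateField.mem_fixingSubgroup_iff] at hσ
    exact hσ ζ (IntermediateField.mem_adjoin_simple_self ℚ ζ)
  set U : Set (absoluteGaloisGroup ℚ) := ((𝒩 : Set _) ∩ (St : Set _)) ∩ (A : Set _) with hU
  have hUopen : IsOpen U := (h𝒩open.inter hStopen).inter hAopen
  set O : Set (absoluteGaloisGroup ℚ) := (fun γ ↦ c₀ * h₀ * γ) '' U with hO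
  have hOopen : IsOpen O := (Homeomorph.mulLeft (c₀ * h₀)).isOpenMap _ hUopen
  have hOne : O.Nonempty := ⟨c₀ * h₀ * 1, 1, ⟨⟨𝒩.one_mem, St.one_mem⟩, A.one_mem⟩, rfl⟩
  obtain ⟨γ, hγO, v, hvS, 𝔓₀, h𝔓₀, hγ⟩ :=
    (absoluteGaloisGroup.frobenius_dense Automorphic.chebotarev_artinRep_holds ℚ S hSfin
      ).inter_open_nonempty O hOopen hOne
  obtain ⟨u, ⟨⟨hu𝒩, huSt⟩, huA⟩, rfl⟩ := hγO
  have huT : u ∈ torsionFixing W (2 : ℤ) := hu𝒩.1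
  have hux : h1Eval W (2 : ℤ) x u = 0 := by simpa [hxs] using hu𝒩.2 true
  have huy : h1Eval W (2 : ℤ) y u = 0 := by simpa [hxs] using hu𝒩.2 false
  have huζ : u • ζ = ζ := huSt
  set t := h₀ * u with ht
  have htT : t ∈ torsionFixing W (2 : ℤ) := mul_mem hh₀T huT
  have htA : t ∈ A := mul_mem hh₀A huA
  have hγt : c₀ * h₀ * u = c₀ * t := by rw [ht, mul_assoc]
  have hvS' : v ∉ S' := fun h ↦ hvS (Or.inr h)
  -- ### the rational prime `ℓ` under `v` and `ℚ_v ≅ ℚ_ℓ`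
  set ℓ : ℕ := (Rat.HeightOneSpectrum.primesEquiv (R := 𝓞 ℚ) v : ℕ) with hℓdef
  have hℓ : ℓ.Prime := (Rat.HeightOneSpectrum.primesEquiv (R := 𝓞 ℚ) v).2
  haveI hℓF : Fact ℓ.Prime := ⟨hℓ⟩
  have hℓv : (ℓ : 𝓞 ℚ) ∈ v.asIdeal := by
    have h := (Rat.HeightOneSpectrum.natGenerator_dvd_iff (R := 𝓞 ℚ) v (n := ℓ)).mp dvd_rfl
    rw [Ideal.mem_map_iff_of_surjective _ (Rat.IsIntegralClosure.intEquiv (𝓞 ℚ)).surjective] at h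
    obtain ⟨z, hz, hzℓ⟩ := h
    have : z = (ℓ : 𝓞 ℚ) :=
      (Rat.IsIntegralClosure.intEquiv (𝓞 ℚ)).injective (by rw [hzℓ, map_natCast])
    rwa [this] at hz
  haveI : CharZero (v.adicCompletion ℚ) :=
    charZero_of_injective_algebraMap (algebraMap ℚ (v.adicCompletion ℚ)).injective
  set θ : v.adicCompletion ℚ ≃+* ℚ_[ℓ] :=
    RingEquivClass.toRingEquiv (Rat.HeightOneSpectrum.adicCompletion.padicEquiv (R := 𝓞 ℚ) v)
    with hθ
  have hℓB : ℓ ∉ B := fun h ↦ hvS (Or.inl ⟨ℓ, h, hℓ, hℓv⟩)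
  simp only [hB, Finset.mem_union, Nat.mem_primeFactors, not_or] at hℓB
  obtain ⟨hℓm', hℓB₀⟩ := hℓB
  have hℓm : ¬ ℓ ∣ m := fun h ↦ hℓm' ⟨hℓ, h, hm⟩
  -- ### `m ∣ ℓ + 1`
  have hmv : (m : 𝓞 ℚ) ∉ v.asIdeal := natCast_not_mem_of_not_dvd hℓ hℓv hℓm
  have h1 : (c₀ * h₀ * u) • ζ = ζ⁻¹ := by
    rw [mul_smul, mul_smul, huζ, hh₀ζ', RatClosure.smul_eq_inv_of_pow_eq_one hc₀ hm hprim.pow_eq_one]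
  have h2 : (c₀ * h₀ * u) • ζ = ζ ^ v.residueCard :=
    smul_eq_pow_residueCard_of_isArithFrobAt_of_pow_eq_one hmv h𝔓₀ hγ hprim.pow_eq_one
  rw [residueCard_eq_of_natCast_mem_rat hℓ hℓv, h1] at h2
  have hζ0 : ζ ≠ 0 := hprim.ne_zero hm
  have hζ1 : ζ ^ (ℓ + 1) = 1 := by rw [pow_succ, ← h2, inv_mul_cancel₀ hζ0]
  have hmdvd : m ∣ ℓ + 1 := (hprim.pow_eq_one_iff_dvd (ℓ + 1)).mp hζ1
  -- ### `[z, γ²] = c₀ [z, h₀] + [z, h₀] ≠ 0` for `z = x, y`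
  have hsq : c₀ * c₀ = 1 := by have h := hc₀.sq_eq_one; rwa [sq] at h
  have hcinv : c₀⁻¹ = c₀ := inv_eq_of_mul_eq_one_right hsq
  have hγγ : (c₀ * h₀ * u) * (c₀ * h₀ * u) = (c₀ * t * c₀⁻¹) * t := by
    rw [hγt, hcinv]; group
  have hconjT : c₀ * t * c₀⁻¹ ∈ torsionFixing W (2 : ℤ) := (torsionFixing_normal W _).conj_mem t htT c₀
  have hγγT : (c₀ * h₀ * u) * (c₀ * h₀ * u) ∈ torsionFixing W (2 : ℤ) := by
    rw [hγγ]; exact mul_mem hconjT htT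
  have hval : ∀ (z : galH1Torsion W (2 : ℤ)), h1Eval W (2 : ℤ) z u = 0 →
      c₀ • h1Eval W (2 : ℤ) z h₀ ≠ h1Eval W (2 : ℤ) z h₀ →
      h1Eval W (2 : ℤ) z ((c₀ * h₀ * u) * (c₀ * h₀ * u)) ≠ 0 := by
    intro z huz hh₀z
    rw [hγγ, h1Eval_mul W _ z hconjT, h1Eval_conj W _ z c₀ htT, ht, h1Eval_mul W _ z hh₀T, huz,
      add_zero]
    intro h0
    apply hh₀z
    have h2v : h1Eval W (2 : ℤ) z h₀ + h1Eval W (2 : ℤ) z h₀ = 0 := by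
      rw [← two_nsmul]; exact AddSubgroup.torsionBy.nsmul _
    rw [eq_neg_of_add_eq_zero_left h0, neg_eq_of_add_eq_zero_left h2v]
  -- ### the local criterion at `v`, then transport to `ℚ_ℓ`
  have hlocx := not_mem_torsionLocalKer_of_h1Eval_sq_ne_zero W (n := 2) two_ne_zero h𝔓₀ hγ hγγT
    (hval x hux hh₀x)
  have hlocy := not_mem_torsionLocalKer_of_h1Eval_sq_ne_zero W (n := 2) two_ne_zero h𝔓₀ hγ hγγT
    (hval y huy hh₀y)
  refine ⟨ℓ, hℓF, hℓB₀, hℓm, hmdvd, ⟨v, 𝔓₀, t, hvS', hℓv, h𝔓₀, hγt ▸ hγ, htT, htA⟩,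
    fun hx' ↦ hlocx ?_, fun hy' ↦ hlocy ?_⟩
  · exact (mem_torsionLocalKer_padic_iff W θ (2 : ℤ) x).mp hx'
  · exact (mem_torsionLocalKer_padic_iff W θ (2 : ℤ) y).mp hy'

end PairMain

/-! ## §9 Over an imaginary quadratic `K`: Kolyvagin primes (Gross's sense, depth one) at which two
given classes are not strict -/

section Kolyvagin

variable (W : WeierstrassCurve ℚ) [W.IsElliptic] {K : Type} [Field K] [NumberField K]

/-- **KOLYVAGIN TWISTING PRIMES AT `2`.** `W/ℚ` elliptic with `Δ(W) < 0` and `ρ̄_{W,2}` onto, `K`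
imaginary quadratic, `x, y ≠ 0` in `H¹(ℚ, E[2])`, `m ≥ 1`, `N ≥ 1`, `B₀` a finite set of rational primes.
Then there is a prime `ℓ ∉ B₀` with `m ∣ ℓ + 1` which is a KOLYVAGIN PRIME for `(E, K, 2)` at level `N`
in Gross's sense (`IsKolyvaginPrime N W K 2 ℓ`: `ℓ ∤ 2 N d_K`, `(ℓ)` inert in `K`, `Frob_ℓ = Frob_∞` in
`Gal(K(E[2])/ℚ)` — hence Zhang's at `2`, `a_ℓ` even, via the line's `zhang_isKolyvaginPrime_two_of_isKolyvaginPrime`)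
and at which BOTH `x_ℓ ≠ 0` and `y_ℓ ≠ 0` (`x, y ∉ ker (H¹(ℚ, E[2]) → H¹(ℚ_ℓ, E[2]))`, Mazur–Rubin's
«not strict at `ℓ`»). From `exists_twistingPrime_pair` with `A = Γ_K ≤ Γ_ℚ` (index `2`, so it contains
every commutator), the places ramified in `K` avoided, and inertness read off as in McCallum's Cor. 3.2
(`FrobeniusPlaces.exists_place_inert_of_not_mem_range`). Depth ONE only (`Frob = c₀` on `E[2]`, not on
`E[4]`): the Selmer half of the LEVEL LAW's prime-level supply (memo `Lines/genus-supply-depthlaw.md` §3).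
[cite: McCallumLMS1991, §3 Cor. 3.2] [cite: GrossLMS1991, §3 (3.1)–(3.2), §9 Prop. 9.6]
[cite: MazurRubin2010, Prop. 3.3 and Lemma 3.5] -/
theorem exists_kolyvaginPrime_not_mem_torsionLocalKer_pair (hsurj : W.HasSurjectiveModNGaloisRep 2)
    (hΔ : W.Δ < 0) (hK : IsImaginaryQuadratic K) {x y : galH1Torsion W (2 : ℤ)} (hx : x ≠ 0) (hy : y ≠ 0)
    {m : ℕ} (hm : m ≠ 0) (N : ℕ) [NeZero N] (B₀ : Finset ℕ) :
    ∃ ℓ : ℕ, ∃ _ : Fact ℓ.Prime, ℓ ∉ B₀ ∧ m ∣ ℓ + 1 ∧ IsKolyvaginPrime N W K 2 ℓ ∧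
      x ∉ W.torsionLocalKer ℚ_[ℓ] (2 : ℤ) ∧ y ∉ W.torsionLocalKer ℚ_[ℓ] (2 : ℤ) := by
  classical
  obtain ⟨c₀, hc₀⟩ := exists_isComplexConjugation (Rat.castHom ℝ)
  haveI : Algebra.IsQuadraticExtension ℚ K := ⟨hK.1⟩
  haveI : IsTotallyComplex K := hK.2
  set H := (absGaloisRestrict ℚ K).range with hH
  have hHi : H.index = 2 := (index_range_absGaloisRestrict_eq_finrank ℚ K).trans hK.1
  haveI hHn : H.Normal := Subgroup.normal_of_index_eq_two hHi
  have hA : ∀ γ δ : absoluteGaloisGroup ℚ, γ * δ * γ⁻¹ * δ⁻¹ ∈ H := fun γ δ ↦ by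
    rw [Subgroup.mul_mem_iff_of_index_two hHi, Subgroup.mul_mem_iff_of_index_two hHi,
      Subgroup.mul_mem_iff_of_index_two hHi, inv_mem_iff, inv_mem_iff]
    tauto
  have hHopen : IsOpen (H : Set (absoluteGaloisGroup ℚ)) := by
    have h := (isOpenMap_absGaloisRestrict (K := K)) _ isOpen_univ
    rw [Set.image_univ] at h
    convert h using 1
    ext σ
    simp only [hH, SetLike.mem_coe, MonoidHom.mem_range, Set.mem_range]
    rfl
  set B : Finset ℕ := B₀ ∪ N.primeFactors ∪ (NumberField.discr K).natAbs.primeFactors ∪ {2} with hB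
  set S' : Set (HeightOneSpectrum (𝓞 ℚ)) := {v | ¬ Algebra.IsUnramifiedIn (𝓞 K) v.asIdeal} with hS'
  have hS'fin : S'.Finite := finite_setOf_not_isUnramifiedIn ℚ K
  obtain ⟨ℓ, hℓF, hℓB, hℓm, hmdvd, ⟨v, 𝔓₀, t, hvS', hℓv, h𝔓₀, hF, htT, htH⟩, hxℓ, hyℓ⟩ :=
    exists_twistingPrime_pair W hsurj hΔ hc₀ hx hy H hHopen hA hm B hS'fin
  have hℓ : ℓ.Prime := hℓF.out
  simp only [hB, Finset.mem_union, Finset.mem_singleton, Nat.mem_primeFactors, not_or] at hℓB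
  obtain ⟨⟨⟨hℓB₀, hℓN⟩, hℓD⟩, hℓ2⟩ := hℓB
  have hℓN' : ¬ ℓ ∣ N := fun h ↦ hℓN ⟨hℓ, h, NeZero.ne N⟩
  have hℓD' : ¬ ((ℓ : ℤ) ∣ NumberField.discr K) := fun h ↦
    hℓD ⟨hℓ, Int.natAbs_dvd_natAbs.mpr h |>.trans (by simp), by simp [NumberField.discr_ne_zero]⟩
  have hunr : Algebra.IsUnramifiedIn (𝓞 K) v.asIdeal := by
    by_contra h; exact hvS' h
  -- ### `ℓ` is inert in `K` (McCallum Cor. 3.2 (1) ⟹ inertness, via `FrobeniusPlaces`)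
  have hI := inertia_le_range_absGaloisRestrict_of_isUnramifiedIn (K := K) hunr h𝔓₀
  have hΦH : c₀ * t ∉ H := by
    intro h
    apply hc₀.not_mem_range_absGaloisRestrict (L := K) IsTotallyComplex.isComplex
    change c₀ ∈ ((absGaloisRestrict ℚ K).range : Set (absoluteGaloisGroup ℚ))
    have h' : c₀ = c₀ * t * t⁻¹ := by group
    rw [SetLike.mem_coe, h']
    exact Subgroup.mul_mem _ h (Subgroup.inv_mem _ htH)
  obtain ⟨w, 𝔔, τ', hwv, hwuniq, -, -, -, -, -⟩ :=
    exists_place_inert_of_not_mem_range (F := ℚ) (M := K) (hK.1 ▸ Nat.prime_two) hHn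
      (index_range_absGaloisRestrict_eq_finrank ℚ K) hunr h𝔓₀ hI hF hΦH
  have hℓw : (ℓ : 𝓞 K) ∈ w.asIdeal := by
    have h1 : (ℓ : 𝓞 ℚ) ∈ (w.under (𝓞 ℚ)).asIdeal := by rw [hwv]; exact hℓv
    rw [HeightOneSpectrum.under_asIdeal, Ideal.under_def, Ideal.mem_comap, map_natCast] at h1
    exact h1
  have hwuniq' : ∀ w' : HeightOneSpectrum (𝓞 K), (ℓ : 𝓞 K) ∈ w'.asIdeal → w' = w := by
    intro w' hw'
    apply hwuniq
    apply HeightOneSpectrum.eq_of_natCast_mem_rat hℓ _ hℓv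
    rw [HeightOneSpectrum.under_asIdeal, Ideal.under_def, Ideal.mem_comap, map_natCast]
    exact hw'
  have hspan : Ideal.span {(ℓ : 𝓞 K)} = w.asIdeal := by
    apply span_natCast_eq_of_unique hℓ w hwuniq'
    haveI : w.asIdeal.LiesOver v.asIdeal := ⟨by rw [← hwv]; rfl⟩
    have hmap : v.asIdeal.map (algebraMap (𝓞 ℚ) (𝓞 K)) = Ideal.span {(ℓ : 𝓞 K)} := by
      rw [← span_natCast_rat_eq hℓ hℓv, Ideal.map_span, Set.image_singleton, map_natCast]
    have hne : v.asIdeal.map (algebraMap (𝓞 ℚ) (𝓞 K)) ≠ ⊥ := by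
      rw [hmap, Ne, Ideal.span_singleton_eq_bot]; exact_mod_cast hℓ.ne_zero
    rw [← hmap, ← Ideal.IsDedekindDomain.ramificationIdx_eq_normalizedFactors_count v.asIdeal
      w.asIdeal hne]
    exact Ideal.ramificationIdx_eq_one_iff.mpr (hunr w.asIdeal w.isPrime inferInstance)
  -- ### `Frob(ℓ) = Frob(∞)` on `E[2]` and on `K`
  obtain ⟨g, hg⟩ := htH
  have hg' : absGaloisRestrict ℚ K g = t := hg
  have hFrob : FrobEqFrobInfty W K 2 ℓ := by
    refine ⟨v, 𝔓₀, c₀ * t, c₀, hℓv, h𝔓₀, hF, hc₀, fun P ↦ ?_, fun e z ↦ ?_⟩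
    · rw [mul_smul]
      exact congrArg (c₀ • ·) (smul_eq_of_mem_torsionFixing W (2 : ℤ) htT P)
    · rw [mul_smul, ← hg', absGaloisRestrict_smul_apply_eq g e z]
  exact ⟨ℓ, hℓF, hℓB₀, hmdvd, ⟨hℓ, hℓN', hℓD', hℓ2, hspan ▸ w.isPrime, hFrob⟩, hxℓ, hyℓ⟩

end Kolyvagin

end Summit.BirchSwinnertonDyer.BirchSwinnertonDyer.Theorems.GenusKolyTwistingPrime

end
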